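import Literature.NumberTheory.Rogawski1990.UnitFundamentalLemmaInertFlickerTorus      -- ★ (F0) FILE 2: the literals, sign vectors
import Literature.NumberTheory.Rogawski1990.LocalStableClassesNonsplitKappaCount       -- ★ p840588 `forall_normTest_iff_of_mk_eq_mk` (+ ★ B-p04 count)
import HarnessLib

/-!
# Flicker's Prop. 3 at a non-split place, `Φ₃`-natively: the local stable class of `t₁` in `U(Φ₃)(F_v)` is `{⟦t₁⟧, ⟦t_π⟧, ⟦t₃⟧, ⟦t₄⟧}`,
# four distinct classes (Flicker 1998 §2 Prop. 3; Rogawski 1990 §3.5–3.6)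

Topic `NumberTheory/Rogawski1990`; namespace `Literature.NumberTheory.Rogawski1990`.  **Theorems only** (no `def`, no instance, no notation, no named
fact, no `sorry`); imports = tree.  Brick (F0) FILE 3 of the road «N7-ns COUNT FROM FLICKER» (LEAD F0P3a-plan T8-43), sequel of ★ FILE 2
`UnitFundamentalLemmaInertFlickerTorus` (the literals `t_θ`, frames `P_θ, P₃, P₄`, conjugators `diag(θ,1,1), g₃, g₄`, the four sign vectors) over ★
`LocalStableClassesNonsplitTypeOneCount` (B-p04: the class criterion and the count `4`) and ★ `LocalStableClassesNonsplitKappaCount`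
(`forall_normTest_iff_of_mk_eq_mk`): on the carrier `E_v = LocalRing E v` at a non-split place (`σ = conjLocal E c v`), with Flicker's `π ∉ N(E_v^×)`,
`2 = σ(x) x`, `−2 = σ(y) y`, the `U(Φ₃)(F_v)`-classes inside the stable class of `t₁ = t_1(a,b,d)` are EXACTLY the classes of `t₁`,
`diag(π,1,1) t₁ diag(π,1,1)⁻¹ = t_π(a,b,d)`, `g₃ t₁ g₃⁻¹ = t_π(a,d,b)`, `g₄ t₁ g₄⁻¹ = t_π(b,a,d)`, pairwise distinct (**`conjClassesIn_flickerTorusElt_eq`**).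
(Flicker's `(a,b,c)` is `(a,b,d)` here: `c` names the conjugation of `E∕F` in this topic's binders.)

Also: the norm tests of the four conjugators against `P₁` in ★ B-p04's shape (`normTest_one_conj_iff`, `normTest_diag_conj_iff`,
`normTest_gThree_conj_iff`, `normTest_gFour_conj_iff` — any field), `conj_mem_unitaryGroup_of_mul_eq` (how the consumer forms `⟨g t₁ g⁻¹, _⟩` from ★
FILE 2's `g t₁ = t′ g` and `ᵗσ(t′) Φ₃ t′ = Φ₃`), `antidiagOne_map_transpose`, `isUnit_det_antidiagOne_three`.

Downstream ((F12), the count junction): with ★ (F0) FILE 1 `exists_frame_of_nonsplit` (`e : G′_v ≃ₜ* U(σ_w,Φ₃)(L_w)`), ★ FILE 2 (`twistGram_formCongr`)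
and ★ `LocalStableClassesNonsplitKappaCount`, the `finsum` over `conjClassesIn` of the clause N7-ns becomes Flicker's four-term sum
`Φ(t₁) + Φ(t₂) − Φ(t₃) − Φ(t₄)` (middle-slot test: passes on `t₁, t_π`, fails on `t₃, t₄`).

Elaboration note: the four elements enter as `τ₁ τ_π τ₃ τ₄ : ↥U` with `τ.val = g t₁ g⁻¹` hypotheses so that `unitaryGroup (conjLocal E c v) Φ₃` is written
once (each syntactic occurrence costs ≈ 1 s of instance search on the `Π`-carrier `LocalRing E v`).

## References
* Y. Z. Flicker, *Elementary proof of the fundamental lemma for a unitary group*, Canad. J. Math. 50 (1998) 74–98, §2 Prop. 3 pp. 78–79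
  [Flicker1998UnitaryFL].
* J. Rogawski, *Automorphic Representations of Unitary Groups in Three Variables*, Ann. of Math. Stud. 123 (1990), §3.1 p. 19, §3.5 Prop. 3.5.2 (a)(c)
  p. 29, §3.6 p. 31 [Rogawski1990].
* C. P. Mok, *Endoscopic classification of representations of quasi-split unitary groups*, Mem. AMS 235 (2015), §1 p. 5 (`Φ_N`) [Mok2014].
-/

set_option autoImplicit false

noncomputable section

open Matrix NumberField IsDedekindDomain
open scoped MatrixGroups

namespace Literature.NumberTheory.Rogawski1990

open Literature.NumberTheory.Automorphic Literature.NumberTheory.Automorphic.UnitaryGroup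
open Literature.AlgebraicGeometry.ShimuraVarieties (unitaryGroup)

section LocalClasses

variable {F : Type} (E : Type) [Field F] [NumberField F] [Field E] [NumberField E] [Algebra F E]
  [Algebra.IsQuadraticExtension F E] (v : HeightOneSpectrum (𝓞 F)) (c : E ≃ₐ[F] E) {δ : E} (hcδ : c δ = -δ) (hδ : δ ≠ 0)

/-- `(g t g⁻¹).val = M` from `g.val · t.val = M · g.val` in `GL_n`. [folklore] -/
private theorem val_conj_eq_of_mul_eq {n : Type*} [Fintype n] [DecidableEq n] {R : Type*} [CommRing R] {g t : GL n R} {M : Matrix n n R}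
    (h : g.val * t.val = M * g.val) : (g * t * g⁻¹).val = M := by
  rw [Units.val_mul, Units.val_mul, h, Matrix.mul_assoc, ← Units.val_mul, mul_inv_cancel, Units.val_one, Matrix.mul_one]

/-- A four-element set with pairwise distinct members has `ncard = 4`. [folklore] -/
private theorem ncard_four' {α : Type*} {p q r s : α} (hpq : p ≠ q) (hpr : p ≠ r) (hps : p ≠ s) (hqr : q ≠ r) (hqs : q ≠ s) (hrs : r ≠ s) :
    ({p, q, r, s} : Set α).ncard = 4 := by
  rw [Set.ncard_insert_of_notMem (by simp [hpq, hpr, hps]), Set.ncard_insert_of_notMem (by simp [hqr, hqs]), Set.ncard_pair hrs]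

/-- `Φ₃ = antidiag(1,1,1)` is `σ`-hermitian for every ring endomorphism `σ`. [cite: Mok2014, §1 Notation p. 5] -/
theorem antidiagOne_map_transpose {R : Type*} [CommRing R] (σ : R →+* R) :
    ((Matrix.of fun i j : Fin 3 => if i.val + j.val + 1 = 3 then (1 : R) else 0).map σ)ᵀ =
      Matrix.of fun i j : Fin 3 => if i.val + j.val + 1 = 3 then (1 : R) else 0 := by
  rw [antidiagOne_map]
  ext i j
  simp only [Matrix.transpose_apply, Matrix.of_apply]
  rw [Nat.add_comm j.val i.val]

/-- `det Φ₃ = −1`, a unit. [cite: Mok2014, §1 Notation p. 5] -/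
theorem isUnit_det_antidiagOne_three {R : Type*} [CommRing R] :
    IsUnit (Matrix.det (Matrix.of fun i j : Fin 3 => if i.val + j.val + 1 = 3 then (1 : R) else 0)) := by
  have h : Matrix.det (Matrix.of fun i j : Fin 3 => if i.val + j.val + 1 = 3 then (1 : R) else 0) = -1 := by
    rw [Matrix.det_fin_three]
    simp [Matrix.of_apply]
  rw [h]
  exact isUnit_one.neg

/-- Distinct sign vectors separate: if the tests of `g₁`, `g₂` read `ε₁`, `ε₂` and agree slot by slot, then `ε₁ = ε₂`. [folklore] -/
private theorem signs_eq_of_tests_iff {ι : Type*} {T₁ T₂ : ι → Prop} {ε₁ ε₂ : ι → ZMod 2} (h₁ : ∀ i, (T₁ i ↔ ε₁ i = 0))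
    (h₂ : ∀ i, (T₂ i ↔ ε₂ i = 0)) (hsep : ∀ i, (T₂ i ↔ T₁ i)) : ε₁ = ε₂ := by
  funext i
  have h01 : ∀ t : ZMod 2, t = 0 ∨ t = 1 := by decide
  have key : (ε₂ i = 0 ↔ ε₁ i = 0) := ((h₂ i).symm.trans (hsep i)).trans (h₁ i)
  rcases h01 (ε₁ i) with ha | ha <;> rcases h01 (ε₂ i) with hb | hb
  · rw [ha, hb]
  · exact absurd (key.2 ha) (by rw [hb]; decide)
  · exact absurd (key.1 hb) (by rw [ha]; decide)
  · rw [ha, hb]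

/-- `![a, b, d]` is injective for pairwise distinct `a, b, d`. [folklore] -/
private theorem injective_vecThree {α : Type*} {a b d : α} (hab : a ≠ b) (hbd : b ≠ d) (had : a ≠ d) : Function.Injective ![a, b, d] := by
  intro i j hij
  fin_cases i <;> fin_cases j
  all_goals first | rfl | (exfalso; revert hij; simp [hab, hbd, had, hab.symm, hbd.symm, had.symm])

section FieldTests

variable {K : Type*} [Field K] (σ : K →+* K)

/-- The tests of the conjugator `diag(π,1,1)` against `P₁` read `(1,0,1)` (★ `normTest_flickerFrame_pi_iff` on `diag(π,1,1) P₁ = P_π`).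
[cite: Flicker1998UnitaryFL, §2 Prop. 3 p. 79] [cite: Rogawski1990, §3.5 Prop. 3.5.2 (a) p. 29] -/
theorem normTest_diag_conj_iff {π : K} (hσπ : σ π = π) (hπN : ∀ z : K, σ z * z ≠ π) (h2 : (2 : K) ≠ 0) {P₁ dπ : GL (Fin 3) K}
    (hP₁ : P₁.val = !![1, 0, 1; 0, 1, 0; -1, 0, 1]) (hdπ : dπ.val = !![π, 0, 0; 0, 1, 0; 0, 0, 1]) (i : Fin 3) :
    (∃ z : K, IsUnit z ∧
        twistGram σ (Matrix.of fun i j : Fin 3 => if i.val + j.val + 1 = 3 then (1 : K) else 0) (dπ.val * P₁.val) i i =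
          σ z * z * twistGram σ (Matrix.of fun i j : Fin 3 => if i.val + j.val + 1 = 3 then (1 : K) else 0) P₁.val i i) ↔
      (![1, 0, 1] : Fin 3 → ZMod 2) i = 0 := by
  rw [hdπ, hP₁, diag_mul_flickerFrame_one]
  exact normTest_flickerFrame_pi_iff σ hσπ hπN h2 i

/-- The tests of the conjugator `g₃` against `P₁` read `(1,1,0)` (★ `normTest_frameThree_iff` on `g₃ P₁ = P₃`).
[cite: Flicker1998UnitaryFL, §2 Prop. 3 p. 79] [cite: Rogawski1990, §3.5 Prop. 3.5.2 (a) p. 29] -/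
theorem normTest_gThree_conj_iff {e π x : K} (h2e : 2 * e = 1) (hσπ : σ π = π) (hπN : ∀ z : K, σ z * z ≠ π) (hx : σ x * x = 2)
    (h2 : (2 : K) ≠ 0) {P₁ g₃ : GL (Fin 3) K}
    (hP₁ : P₁.val = !![1, 0, 1; 0, 1, 0; -1, 0, 1]) (hg₃ : g₃.val = !![e * π, π, -(e * π); e, 0, e; -e, 1, e]) (i : Fin 3) :
    (∃ z : K, IsUnit z ∧
        twistGram σ (Matrix.of fun i j : Fin 3 => if i.val + j.val + 1 = 3 then (1 : K) else 0) (g₃.val * P₁.val) i i =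
          σ z * z * twistGram σ (Matrix.of fun i j : Fin 3 => if i.val + j.val + 1 = 3 then (1 : K) else 0) P₁.val i i) ↔
      (![1, 1, 0] : Fin 3 → ZMod 2) i = 0 := by
  rw [hg₃, hP₁, gThree_mul_flickerFrame_one h2e]
  exact normTest_frameThree_iff σ hσπ hπN hx h2 i

/-- The tests of the conjugator `g₄` against `P₁` read `(0,1,1)` (★ `normTest_frameFour_iff` on `g₄ P₁ = P₄`).
[cite: Flicker1998UnitaryFL, §2 Prop. 3 p. 79] [cite: Rogawski1990, §3.5 Prop. 3.5.2 (a) p. 29] -/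
theorem normTest_gFour_conj_iff {e π y : K} (h2e : 2 * e = 1) (hσπ : σ π = π) (hπN : ∀ z : K, σ z * z ≠ π) (hy : σ y * y = -2)
    (h2 : (2 : K) ≠ 0) {P₁ g₄ : GL (Fin 3) K}
    (hP₁ : P₁.val = !![1, 0, 1; 0, 1, 0; -1, 0, 1]) (hg₄ : g₄.val = !![e * π, π, e * π; e, 0, -e; e, -1, e]) (i : Fin 3) :
    (∃ z : K, IsUnit z ∧
        twistGram σ (Matrix.of fun i j : Fin 3 => if i.val + j.val + 1 = 3 then (1 : K) else 0) (g₄.val * P₁.val) i i =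
          σ z * z * twistGram σ (Matrix.of fun i j : Fin 3 => if i.val + j.val + 1 = 3 then (1 : K) else 0) P₁.val i i) ↔
      (![0, 1, 1] : Fin 3 → ZMod 2) i = 0 := by
  rw [hg₄, hP₁, gFour_mul_flickerFrame_one h2e]
  exact normTest_frameFour_iff σ hσπ hπN hy h2 i

/-- The tests of the trivial conjugator `1` against `P₁` read `(0,0,0)`. [cite: Rogawski1990, §3.5 Prop. 3.5.2 (a) p. 29] -/
theorem normTest_one_conj_iff (P₁ : GL (Fin 3) K) (i : Fin 3) :
    (∃ z : K, IsUnit z ∧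
        twistGram σ (Matrix.of fun i j : Fin 3 => if i.val + j.val + 1 = 3 then (1 : K) else 0) ((1 : GL (Fin 3) K).val * P₁.val) i i =
          σ z * z * twistGram σ (Matrix.of fun i j : Fin 3 => if i.val + j.val + 1 = 3 then (1 : K) else 0) P₁.val i i) ↔
      (![0, 0, 0] : Fin 3 → ZMod 2) i = 0 := by
  rw [Units.val_one, Matrix.one_mul]
  exact normTest_flickerFrame_one_iff σ P₁.val i

end FieldTests

/-- **Conjugates into `U(σ, H)`**: if `g · t = M · g` in `GL_n` and `M` preserves `H` (`ᵗσ(M) H M = H`) then `g t g⁻¹ ∈ U(σ, H)` — how the classes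
`⟦g t₁ g⁻¹⟧` below are formed from ★ FILE 2's identities `g t₁ = t′ g` and `ᵗσ(t′) Φ₃ t′ = Φ₃`. [cite: Rogawski1990, §3.1 p. 19] -/
theorem conj_mem_unitaryGroup_of_mul_eq {R : Type*} [CommRing R] (σ : R →+* R) {n : Type*} [Fintype n] [DecidableEq n]
    (H : Matrix n n R) {g t : GL n R} {M : Matrix n n R} (hmul : g.val * t.val = M * g.val) (hM : (M.map σ)ᵀ * H * M = H) :
    g * t * g⁻¹ ∈ unitaryGroup σ H := by
  rw [Literature.AlgebraicGeometry.ShimuraVarieties.mem_unitaryGroup_iff]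
  have hval : ((g * t * g⁻¹ : GL n R) : Matrix n n R) = M := val_conj_eq_of_mul_eq hmul
  rw [hval, hM]

include hcδ hδ in
/-- **FLICKER'S PROP. 3 (type (1), `Φ₃`-native) — THE LOCAL STABLE CLASS OF `t₁` IS `{⟦t₁⟧, ⟦t_π⟧, ⟦t₃⟧, ⟦t₄⟧}`, FOUR DISTINCT CLASSES.**
At a non-split place `v` of `F` (`K = E_v`, `σ = c ⊗ 1`), for pairwise distinct `a, b, d ∈ E_v¹` (Flicker's `(a,b,c)`; `c` names the conjugation here),
`e = ½`, `π ∈ F_v` NOT a norm from `E_v` (a uniformiser), `2 = σ(x)x`, `−2 = σ(y)y` (units are norms, `E∕F` unramified, `p ≠ 2`): let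
`τ₁, τ_π, τ₃, τ₄ ∈ U(Φ₃)(F_v)` with `τ₁ = t₁ = !![e(a+d), 0, −e(a−d); 0, b, 0; −e(a−d), 0, e(a+d)]`, `τ_π = diag(π,1,1) τ₁ diag(π,1,1)⁻¹` (`= t_π(a,b,d)`),
`τ₃ = g₃ τ₁ g₃⁻¹` (`= t_π(a,d,b)`), `τ₄ = g₄ τ₁ g₄⁻¹` (`= t_π(b,a,d)`) for the literals `P₁, diag(π,1,1), g₃, g₄` of ★ `UnitFundamentalLemmaInertFlickerTorus`
(memberships: `conj_mem_unitaryGroup_of_mul_eq` with ★ FILE 2).  Then the `U(Φ₃)(F_v)`-classes inside the stable class of `τ₁` (★ `conjClassesIn`) are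
`{⟦τ₁⟧, ⟦τ_π⟧, ⟦τ₃⟧, ⟦τ₄⟧}`, pairwise distinct (sign vectors `(0,0,0), (1,0,1), (1,1,0), (0,1,1)` of ★ FILE 2 §2, separated by ★
`forall_normTest_iff_of_mk_eq_mk`; exhaustion by ★ `ncard_conjClassesIn_eq_four`). [cite: Flicker1998UnitaryFL, §2 Prop. 3 pp. 78–79]
[cite: Rogawski1990, §3.5 Prop. 3.5.2 (a)(c) p. 29; §3.6 p. 31] -/
theorem conjClassesIn_flickerTorusElt_eq (w : PlacesOver E v) (hw : c • w.1 = w.1)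
    {e π x y a b d : LocalRing E v} (h2 : 2 * e = 1) (hσπ : conjLocal E c v π = π)
    (hπN : ∀ z : LocalRing E v, conjLocal E c v z * z ≠ π) (hx : conjLocal E c v x * x = 2) (hy : conjLocal E c v y * y = -2)
    (ha : conjLocal E c v a * a = 1) (hb : conjLocal E c v b * b = 1) (hd : conjLocal E c v d * d = 1)
    (hab : a ≠ b) (hbd : b ≠ d) (had : a ≠ d)
    {P₁ dπ g₃ g₄ : GL (Fin 3) (LocalRing E v)}
    (hP₁ : P₁.val = !![1, 0, 1; 0, 1, 0; -1, 0, 1]) (hdπ : dπ.val = !![π, 0, 0; 0, 1, 0; 0, 0, 1])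
    (hg₃ : g₃.val = !![e * π, π, -(e * π); e, 0, e; -e, 1, e]) (hg₄ : g₄.val = !![e * π, π, e * π; e, 0, -e; e, -1, e])
    {τ₁ τπ τ₃ τ₄ : ↥(unitaryGroup (conjLocal E c v) (Matrix.of fun i j : Fin 3 => if i.val + j.val + 1 = 3 then (1 : LocalRing E v) else 0))}
    (hτ₁ : τ₁.val.val = !![e * (a + d), 0, -(e * (a - d)); 0, b, 0; -(e * (a - d)), 0, e * (a + d)])
    (hτπ : τπ.val = dπ * τ₁.val * dπ⁻¹) (hτ₃ : τ₃.val = g₃ * τ₁.val * g₃⁻¹) (hτ₄ : τ₄.val = g₄ * τ₁.val * g₄⁻¹) :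
    conjClassesIn (conjLocal E c v) (Matrix.of fun i j : Fin 3 => if i.val + j.val + 1 = 3 then (1 : LocalRing E v) else 0) τ₁ =
        {ConjClasses.mk τ₁, ConjClasses.mk τπ, ConjClasses.mk τ₃, ConjClasses.mk τ₄} ∧
      ConjClasses.mk τ₁ ≠ ConjClasses.mk τπ ∧ ConjClasses.mk τ₁ ≠ ConjClasses.mk τ₃ ∧ ConjClasses.mk τ₁ ≠ ConjClasses.mk τ₄ ∧
      ConjClasses.mk τπ ≠ ConjClasses.mk τ₃ ∧ ConjClasses.mk τπ ≠ ConjClasses.mk τ₄ ∧ ConjClasses.mk τ₃ ≠ ConjClasses.mk τ₄ := by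
  classical
  letI : Field (LocalRing E v) :=
    (Liu2021.LemD1IndexedNonVacuityNonsplitPlace.isField_localRing_of_nonsplit E v c hcδ hδ w hw).toField
  have h20 : (2 : LocalRing E v) ≠ 0 := fun h0 => by
    have h1 := h2; rw [h0, zero_mul] at h1; exact zero_ne_one h1
  -- hermitian data of `Φ₃`
  have hH := antidiagOne_map_transpose (R := LocalRing E v) (conjLocal E c v)
  have hHd := isUnit_det_antidiagOne_three (R := LocalRing E v)
  -- destructure the four elements, then abstract the unitary group once
  obtain ⟨t₁, hU₁⟩ := τ₁
  obtain ⟨tπ, hUπ⟩ := τπ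
  obtain ⟨t₃, hU₃⟩ := τ₃
  obtain ⟨t₄, hU₄⟩ := τ₄
  simp only at hτ₁ hτπ hτ₃ hτ₄
  subst hτπ hτ₃ hτ₄
  revert hU₁ hUπ hU₃ hU₄
  set U := unitaryGroup (conjLocal E c v) (Matrix.of fun i j : Fin 3 => if i.val + j.val + 1 = 3 then (1 : LocalRing E v) else 0) with hU
  intro hU₁ hUπ hU₃ hU₄
  -- the eigenframe of `t₁`
  have hP : t₁.val * P₁.val = P₁.val * diagonal ![a, b, d] := by
    rw [hτ₁, hP₁, flickerTorusElt_one_mul_frame h2, etaDiag_eq_diagonal]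
  have hu : Function.Injective ![a, b, d] := injective_vecThree hab hbd had
  have hu1 : ∀ i, conjLocal E c v (![a, b, d] i) * ![a, b, d] i = 1 := by
    intro i
    fin_cases i
    · exact ha
    · exact hb
    · exact hd
  -- `t₁` as the trivial conjugate
  have h1U : (1 : GL (Fin 3) (LocalRing E v)) * t₁ * 1⁻¹ ∈ U := by
    rw [one_mul, inv_one, mul_one]; exact hU₁
  have e₁ : (⟨t₁, hU₁⟩ : ↥U) = ⟨1 * t₁ * 1⁻¹, h1U⟩ := Subtype.ext (show t₁ = 1 * t₁ * 1⁻¹ by rw [one_mul, inv_one, mul_one])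
  -- the norm tests of a stable conjugator, relative to the frame `P₁`
  set T : GL (Fin 3) (LocalRing E v) → Fin 3 → Prop := fun g i =>
    ∃ z : LocalRing E v, IsUnit z ∧
      twistGram (conjLocal E c v) (Matrix.of fun i j : Fin 3 => if i.val + j.val + 1 = 3 then (1 : LocalRing E v) else 0) (g.val * P₁.val) i i =
        conjLocal E c v z * z *
          twistGram (conjLocal E c v) (Matrix.of fun i j : Fin 3 => if i.val + j.val + 1 = 3 then (1 : LocalRing E v) else 0) P₁.val i i with hT
  -- sign vectors (★ FILE 2 §2)
  have hT1 : ∀ i, (T 1 i ↔ (![0, 0, 0] : Fin 3 → ZMod 2) i = 0) := fun i => normTest_one_conj_iff (conjLocal E c v) P₁ i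
  have hTπ : ∀ i, (T dπ i ↔ (![1, 0, 1] : Fin 3 → ZMod 2) i = 0) := fun i => normTest_diag_conj_iff (conjLocal E c v) hσπ hπN h20 hP₁ hdπ i
  have hT3 : ∀ i, (T g₃ i ↔ (![1, 1, 0] : Fin 3 → ZMod 2) i = 0) := fun i =>
    normTest_gThree_conj_iff (conjLocal E c v) h2 hσπ hπN hx h20 hP₁ hg₃ i
  have hT4 : ∀ i, (T g₄ i ↔ (![0, 1, 1] : Fin 3 → ZMod 2) i = 0) := fun i =>
    normTest_gFour_conj_iff (conjLocal E c v) h2 hσπ hπN hy h20 hP₁ hg₄ i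
  -- equal classes have equal tests (★ p840588), hence equal sign vectors
  have ne_of_signs : ∀ {g₁ g₂ : GL (Fin 3) (LocalRing E v)} (h₁ : g₁ * t₁ * g₁⁻¹ ∈ U) (h₂ : g₂ * t₁ * g₂⁻¹ ∈ U)
      {ε₁ ε₂ : Fin 3 → ZMod 2} (hε₁ : ∀ i, (T g₁ i ↔ ε₁ i = 0)) (hε₂ : ∀ i, (T g₂ i ↔ ε₂ i = 0)) (hne : ε₁ ≠ ε₂),
      ConjClasses.mk (⟨g₁ * t₁ * g₁⁻¹, h₁⟩ : ↥U) ≠ ConjClasses.mk ⟨g₂ * t₁ * g₂⁻¹, h₂⟩ := by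
    intro g₁ g₂ h₁ h₂ ε₁ ε₂ hε₁ hε₂ hne hmk
    exact hne (signs_eq_of_tests_iff hε₁ hε₂ (fun i => forall_normTest_iff_of_mk_eq_mk E v c hcδ hδ w hw hH hHd hU₁ hP hu hu1 hmk i))
  have n1π : ConjClasses.mk (⟨t₁, hU₁⟩ : ↥U) ≠ ConjClasses.mk ⟨dπ * t₁ * dπ⁻¹, hUπ⟩ := by
    rw [e₁]; exact ne_of_signs h1U hUπ hT1 hTπ (by decide)
  have n13 : ConjClasses.mk (⟨t₁, hU₁⟩ : ↥U) ≠ ConjClasses.mk ⟨g₃ * t₁ * g₃⁻¹, hU₃⟩ := by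
    rw [e₁]; exact ne_of_signs h1U hU₃ hT1 hT3 (by decide)
  have n14 : ConjClasses.mk (⟨t₁, hU₁⟩ : ↥U) ≠ ConjClasses.mk ⟨g₄ * t₁ * g₄⁻¹, hU₄⟩ := by
    rw [e₁]; exact ne_of_signs h1U hU₄ hT1 hT4 (by decide)
  have nπ3 : ConjClasses.mk (⟨dπ * t₁ * dπ⁻¹, hUπ⟩ : ↥U) ≠ ConjClasses.mk ⟨g₃ * t₁ * g₃⁻¹, hU₃⟩ :=
    ne_of_signs hUπ hU₃ hTπ hT3 (by decide)
  have nπ4 : ConjClasses.mk (⟨dπ * t₁ * dπ⁻¹, hUπ⟩ : ↥U) ≠ ConjClasses.mk ⟨g₄ * t₁ * g₄⁻¹, hU₄⟩ :=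
    ne_of_signs hUπ hU₄ hTπ hT4 (by decide)
  have n34 : ConjClasses.mk (⟨g₃ * t₁ * g₃⁻¹, hU₃⟩ : ↥U) ≠ ConjClasses.mk ⟨g₄ * t₁ * g₄⁻¹, hU₄⟩ :=
    ne_of_signs hU₃ hU₄ hT3 hT4 (by decide)
  -- the four classes lie in the stable class and exhaust it
  have hS4 := ncard_conjClassesIn_eq_four E v c hcδ hδ w hw hH hHd hU₁ hP hu hu1
  have hSfin := finite_conjClassesIn_of_eigenframe E v c hcδ hδ w hw hH hHd hU₁ hP hu hu1
  have hmem : ∀ (g' : GL (Fin 3) (LocalRing E v)) (hg' : g' * t₁ * g'⁻¹ ∈ U),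
      ConjClasses.mk (⟨g' * t₁ * g'⁻¹, hg'⟩ : ↥U) ∈
        conjClassesIn (conjLocal E c v) (Matrix.of fun i j : Fin 3 => if i.val + j.val + 1 = 3 then (1 : LocalRing E v) else 0) ⟨t₁, hU₁⟩ :=
    fun g' hg' => mk_mem_conjClassesIn_iff.2 (isStablyConj_iff.2 ⟨g', rfl⟩)
  have hsub : ({ConjClasses.mk (⟨t₁, hU₁⟩ : ↥U), ConjClasses.mk ⟨dπ * t₁ * dπ⁻¹, hUπ⟩, ConjClasses.mk ⟨g₃ * t₁ * g₃⁻¹, hU₃⟩,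
      ConjClasses.mk ⟨g₄ * t₁ * g₄⁻¹, hU₄⟩} : Set (ConjClasses ↥U)) ⊆
        conjClassesIn (conjLocal E c v) (Matrix.of fun i j : Fin 3 => if i.val + j.val + 1 = 3 then (1 : LocalRing E v) else 0) ⟨t₁, hU₁⟩ := by
    intro z hz
    simp only [Set.mem_insert_iff, Set.mem_singleton_iff] at hz
    rcases hz with rfl | rfl | rfl | rfl
    · exact mk_mem_conjClassesIn_self _
    · exact hmem dπ hUπ
    · exact hmem g₃ hU₃
    · exact hmem g₄ hU₄
  have h4 := ncard_four' n1π n13 n14 nπ3 nπ4 n34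
  have heq := Set.eq_of_subset_of_ncard_le hsub (by rw [hS4, h4]) hSfin
  exact ⟨heq.symm, n1π, n13, n14, nπ3, nπ4, n34⟩

end LocalClasses

end Literature.NumberTheory.Rogawski1990
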